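import Literature.NumberTheory.Rogawski1990.ArchCartanWallExtensionGDocks   -- ★ p850260 (LH3-p02 (g2)): `hcCayPt_mem_inRegG_insert`, `hcCayPt_not_mem_regG_insert`, the Cayley docks (+ ★ `ArchHCSpaceG`, ★ `orbFamGExt`, ★ `mem_closure_regG`, ★ `isOpen_inRegG`)
import HarnessLib

/-!
# (V1-G′) MEMBERSHIP ⇒ THE CAYLEY VALUE IS A LIMIT: a family `C^∞` on Bouaziz's `T_{in-reg}` of the split chart is CONTINUOUS AT the Cayley point of a semiregular wall point, so
# its value there is the `RegG`-limit of the raw member — in particular the limit along the ONE-VARIABLE `x`-ray with every other coordinate frozen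
# (Harish-Chandra ∕ Varadarajan 1977 I §1.12; Shelstad 1979 §4 Lemma 4.3; Bouaziz 1994 §3.1 (I₂))

Topic `NumberTheory/Rogawski1990`; namespace `Literature.NumberTheory.Rogawski1990`.  THEOREMS ONLY (no definition, no instance, no notation, no axiom, no named fact, no `sorry`);
kernel lane `--kind proof --supports stmt-HodgeConjecture-24833`.  Cell `pub/hodgecm-mathlib`, crux H413 (`stmt-HodgeConjecture-24833`), F0∕P3c line LH3 (closer stub `stub_N9` —
archimedean endoscopic transfer — DIRECT ROAD `F0_P3c_StubN9Direct`, skeleton v3.3b): organ **(V1-G′)** of (NONDEG-G′) piece 2b (LH3-plan (g3) RULINGS #7 (a) 2026-09-02T08:03:50Z,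
SPLIT 08:05:04Z «(V1) MEMBERSHIP ⇒ CAYLEY VALUE IS A LIMIT» → LH4-p01 (g3)); consumers F0P3b-p01 (g15) ((V2): the `x`-ray limit `= cof cay · (Kβ · (C₂ · cone fB))`) and LH3-p02 (g3)
((J-G′-SIDE): binds §3 as `hval`).  Author LH4-p01 (g3).

THE POINT (pure chart topology; no group, no measure in §1–§2).  The residual `JumpBricksStatement` of the direct road carries the membership `hHC : ArchHCSpaceG (slotSign L α) jc′ F`
of the wall-extended genuine family `F = orbFamGExt ν′ a′`; its clause (I₁)+(I₂) (★ `ArchHcSmoothOneSided`, first conjunct) says `F (insert w S′)` is `C^∞` on the OPEN set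
★ `InRegG s (insert w S′)` (★ `isOpen_inRegG`).  The Cayley point ★ `hcCayPt w i j p` of a semiregular wall point `p` (★ `HcSemireg S′ w i j p`) LIES IN that open set
(★ `hcCayPt_mem_inRegG_insert`, p850260 — `InRegG` has no condition at the now-split place `w`; the real wall `x_w = 0` is not removed), so `F (insert w S′)` is CONTINUOUS AT the
Cayley point, and its value there is the limit of `F (insert w S′) = G (insert w S′)` (★ `orbFamGExt_eqOn_regG`: the raw member `orbFamG = R′ · chartOrbG` on ★ `RegG`) along ANY filter
finer than `𝓝[RegG (insert w S′)] cay` — in particular along the `x`-RAY `x ↦ cay + x • e_{w,0}` (`x → 0⁺`), which runs in `RegG (insert w S′)` for EVERY `x ≠ 0` (§2) and along which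
(V2) computes the raw member explicitly (★ A0-b∕c p850189∕p850302∕p850345 at FIXED test function, D4b at the Cayley chart, (M-UNFOLD) (6)).  So the «junk value of `extendFrom`»
objection evaporates: under `hHC` the value IS the one-ray limit, and two candidate values agree by uniqueness of limits (`𝓝[>] 0` and `𝓝[RegG] cay` are non-trivial, ★ `mem_closure_regG`).

* §1 ABSTRACT (`f` continuous on `InRegG s (insert w S′)`, `f = g` on `RegG (insert w S′)`): `continuousAt_hcCayPt_of_continuousOn`, **`tendsto_nhdsWithin_regG_hcCayPt_of_continuousOn`**
  (`Tendsto g (𝓝[RegG (insert w S′)] cay) (𝓝 (f cay))`), `…_of_contDiffOn`, `…_of_archHCSpaceG` (projects clause 3.1 of ★ `ArchHCSpaceG`), `nhdsWithin_regG_neBot`, uniqueness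
  `eq_of_tendsto_nhdsWithin_regG_hcCayPt`.
* §2 THE `x`-RAY `hcCayPt w i j p + x • (Pi.single w (Pi.single 0 1 : Fin 3 → ℝ) : W → Fin 3 → ℝ)` (slot table ★ (COORD): split slot `0 = x`; the direction is ★ `hcCayVec w i j (w, i)`, the Cayley image of the
  normal letter — ★ `hcCayVec_normal`): apply lemmas `cayRay_apply_self`, `cayRay_apply_self_zero ∕ _one ∕ _two`, `cayRay_apply_of_ne`, `cayRay_zero`, `tendsto_cayRay`; **`cayRay_mem_regG_insert`**
  (in `RegG (insert w S′)` for EVERY `x ≠ 0`), `tendsto_cayRay_nhdsWithin_regG` (`𝓝[≠] 0`), `tendsto_cayRay_nhdsGT_regG` (`𝓝[>] 0`), `tendsto_comp_cayRay_of_tendsto`,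
  **`tendsto_comp_cayRay_of_continuousOn`**, uniqueness **`eq_of_tendsto_comp_cayRay`**.
* §3 THE GENUINE FAMILY (`f := orbFamGExt ν′ a′ (insert w S′)`, `g := orbFamG ν′ a′ (insert w S′)`, `s := slotSign L α`): **`tendsto_orbFamG_nhdsWithin_regG_hcCayPt`** (from
  `hsm : ContDiffOn ℝ ∞ (orbFamGExt … (insert w S′)) (InRegG (slotSign L α) (insert w S′))`), `…_of_archHCSpaceG` (from the membership `hHC`), `tendsto_orbFamG_cayRay`,
  `tendsto_orbFamG_cayRay_of_archHCSpaceG`, and the (V2)-socket **`orbFamGExt_insert_hcCayPt_eq_of_tendsto_cayRay`**: a computed `x`-ray limit `V` of the raw member IS the value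
  `orbFamGExt ν′ a′ (insert w S′) (hcCayPt w i j p)`.
HONEST LABEL: HC_CM is proved only modulo the 7 printed citations (2 remaining: hLiu418 = `stmt-HodgeConjecture-24832`, h413 = `stmt-HodgeConjecture-24833`) until rung 0 closes;
count-neutral (reading lemmas: no limit is computed and no membership is asserted here).

## References
* [Varadarajan1977] V. S. Varadarajan, *Harmonic Analysis on Real Reductive Groups*, LNM 576 (1977), Part I §1.12 (`'F_f` extends continuously to the closure of each chamber).
* [Shelstad1979] D. Shelstad, *Characters and inner forms of a quasi-split group over ℝ*, Compositio Math. 39 (1979), §4 pp. 22–25, Lemma 4.3 (p. 25) (the Cayley transform at a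
  semiregular point; the value on the adjacent Cartan).
* [Bouaziz1994IntegralesOrbitales] A. Bouaziz, *Intégrales orbitales sur les groupes de Lie réductifs*, Ann. Sci. ÉNS 27 (1994), §3.1 (I₂) p. 579, §6.2 p. 591 (`T_{in-reg}`).
-/

set_option autoImplicit false

noncomputable section

open MeasureTheory MeasureTheory.Measure NumberField NumberField.InfinitePlace Set Filter Topology
open scoped ContDiff
open Literature.NumberTheory.Automorphic Literature.NumberTheory.Automorphic.UnitaryGroup Literature.NumberTheory.Automorphic.ArchCartan
open Literature.NumberTheory.Automorphic.Shelstad1979.StableOrbitalIntegrals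
open Literature.NumberTheory.GaloisRepresentations

namespace Literature.NumberTheory.Rogawski1990

variable {W : Type*}

/-! ## §1 Continuity inside `T_{in-reg}` ⇒ the `RegG`-limit at the Cayley point is the value -/

section Abstract

variable [Fintype W] [DecidableEq W] (s : W → Fin 3 → SignType)

/-- **A function continuous on `InRegG s (insert w S′)` is continuous AT the Cayley point of a semiregular wall point** (★ `InRegG` is open and contains the Cayley point,
★ `hcCayPt_mem_inRegG_insert`). [cite: Bouaziz1994IntegralesOrbitales, §3.1 (I₂) p. 579] [cite: Shelstad1979, Lemma 4.3 (p. 25)] -/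
theorem continuousAt_hcCayPt_of_continuousOn {S' : Finset W} {w : W} {i j : Fin 3} {p : W → Fin 3 → ℝ} (hp : HcSemireg S' w i j p)
    {f : (W → Fin 3 → ℝ) → ℂ} (hf : ContinuousOn f (InRegG s (insert w S'))) : ContinuousAt f (hcCayPt w i j p) :=
  hf.continuousAt ((isOpen_inRegG s (insert w S')).mem_nhds (hcCayPt_mem_inRegG_insert s hp))

/-- **(V1) MEMBERSHIP ⇒ THE CAYLEY VALUE IS THE `RegG`-LIMIT** (abstract form): if `f` is continuous on `InRegG s (insert w S′)` and agrees with `g` on `RegG (insert w S′)`, then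
`g → f (hcCayPt w i j p)` along `𝓝[RegG (insert w S′)] (hcCayPt w i j p)` at every semiregular wall point `p` of the wall `(w, i, j)` of the chart `S′`.
[cite: Varadarajan1977, I §1.12] [cite: Shelstad1979, Lemma 4.3 (p. 25)] [cite: Bouaziz1994IntegralesOrbitales, §3.1 (I₂) p. 579] -/
theorem tendsto_nhdsWithin_regG_hcCayPt_of_continuousOn {S' : Finset W} {w : W} {i j : Fin 3} {p : W → Fin 3 → ℝ} (hp : HcSemireg S' w i j p)
    {f g : (W → Fin 3 → ℝ) → ℂ} (hf : ContinuousOn f (InRegG s (insert w S'))) (hfg : EqOn f g (RegG (insert w S'))) :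
    Tendsto g (𝓝[RegG (insert w S')] (hcCayPt w i j p)) (𝓝 (f (hcCayPt w i j p))) :=
  (tendsto_nhdsWithin_of_tendsto_nhds (continuousAt_hcCayPt_of_continuousOn s hp hf).tendsto).congr'
    (eventually_nhdsWithin_of_forall fun _ hc => hfg hc)

/-- (V1), `C^∞` form: `f` smooth on `InRegG s (insert w S′)` (the first conjunct of ★ `ArchHcSmoothOneSided` on the chart `insert w S′`), `f = g` on `RegG (insert w S′)` ⟹
`g → f (cay)` along `𝓝[RegG (insert w S′)] cay`. [cite: Varadarajan1977, I §1.12] [cite: Bouaziz1994IntegralesOrbitales, §3.1 (I₂) p. 579] -/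
theorem tendsto_nhdsWithin_regG_hcCayPt_of_contDiffOn {S' : Finset W} {w : W} {i j : Fin 3} {p : W → Fin 3 → ℝ} (hp : HcSemireg S' w i j p)
    {f g : (W → Fin 3 → ℝ) → ℂ} (hf : ContDiffOn ℝ ∞ f (InRegG s (insert w S'))) (hfg : EqOn f g (RegG (insert w S'))) :
    Tendsto g (𝓝[RegG (insert w S')] (hcCayPt w i j p)) (𝓝 (f (hcCayPt w i j p))) :=
  tendsto_nhdsWithin_regG_hcCayPt_of_continuousOn s hp hf.continuousOn hfg

/-- (V1), MEMBERSHIP form: for `F ∈ I_c(G′_∞)` (★ `ArchHCSpaceG s jc′ F`; only clause (I₁)+(I₂) on the chart `insert w S′` is read) and a raw member `g = F (insert w S′)` on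
`RegG (insert w S′)`: `g → F (insert w S′) (cay)` along `𝓝[RegG (insert w S′)] cay`. [cite: Bouaziz1994IntegralesOrbitales, §3.1 (I₂) p. 579; §3.2 p. 580] [cite: Varadarajan1977, I §1.12] -/
theorem tendsto_nhdsWithin_regG_hcCayPt_of_archHCSpaceG {S' : Finset W} {w : W} {i j : Fin 3} {p : W → Fin 3 → ℝ} (hp : HcSemireg S' w i j p)
    {jc' : Finset W → W → Fin 3 → Fin 3 → ℂ} {F : Finset W → (W → Fin 3 → ℝ) → ℂ} (hF : ArchHCSpaceG s jc' F) {g : (W → Fin 3 → ℝ) → ℂ}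
    (hFg : EqOn (F (insert w S')) g (RegG (insert w S'))) :
    Tendsto g (𝓝[RegG (insert w S')] (hcCayPt w i j p)) (𝓝 (F (insert w S') (hcCayPt w i j p))) :=
  tendsto_nhdsWithin_regG_hcCayPt_of_contDiffOn s hp (hF.2.2.1 (insert w S')).1 hFg

omit [DecidableEq W] in
/-- `𝓝[RegG S′] c` is non-trivial at EVERY point `c` (★ `RegG S′` is dense, ★ `mem_closure_regG`). [cite: Bouaziz1994IntegralesOrbitales, §3.1 p. 579] -/
theorem nhdsWithin_regG_neBot (S' : Finset W) (c : W → Fin 3 → ℝ) : (𝓝[RegG S'] c).NeBot :=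
  mem_closure_iff_nhdsWithin_neBot.1 (mem_closure_regG S' c)

/-- **UNIQUENESS**: under (V1)'s hypotheses, ANY `RegG (insert w S′)`-limit `V` of `g` at the Cayley point IS the value `f (hcCayPt w i j p)`.
[cite: Varadarajan1977, I §1.12] [cite: Shelstad1979, Lemma 4.3 (p. 25)] -/
theorem eq_of_tendsto_nhdsWithin_regG_hcCayPt {S' : Finset W} {w : W} {i j : Fin 3} {p : W → Fin 3 → ℝ} (hp : HcSemireg S' w i j p)
    {f g : (W → Fin 3 → ℝ) → ℂ} (hf : ContinuousOn f (InRegG s (insert w S'))) (hfg : EqOn f g (RegG (insert w S'))) {V : ℂ}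
    (h : Tendsto g (𝓝[RegG (insert w S')] (hcCayPt w i j p)) (𝓝 V)) : f (hcCayPt w i j p) = V :=
  haveI := nhdsWithin_regG_neBot (insert w S') (hcCayPt w i j p)
  tendsto_nhds_unique (tendsto_nhdsWithin_regG_hcCayPt_of_continuousOn s hp hf hfg) h

end Abstract

/-! ## §2 The `x`-ray of the split chart through the Cayley point -/

section Ray

variable [DecidableEq W]

/-- Coordinates of the `x`-ray at the place `w`: the Cayley point's, plus `x` in slot `0`. [cite: Shelstad1979, §4 p. 25] -/
theorem cayRay_apply_self (p : W → Fin 3 → ℝ) (w : W) (i j : Fin 3) (x : ℝ) (l : Fin 3) :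
    (hcCayPt w i j p + x • (Pi.single w (Pi.single 0 1 : Fin 3 → ℝ) : W → Fin 3 → ℝ)) w l = hcCayPt w i j p w l + (if l = 0 then x else 0) := by
  simp only [Pi.add_apply, Pi.smul_apply, Pi.single_eq_same, Pi.single_apply, smul_eq_mul, mul_ite, mul_one, mul_zero]

/-- Slot `0` (the real coordinate `x_w` of the split chart) of the `x`-ray is `x`. [cite: Shelstad1979, §4 p. 25] -/
@[simp] theorem cayRay_apply_self_zero (p : W → Fin 3 → ℝ) (w : W) (i j : Fin 3) (x : ℝ) :
    (hcCayPt w i j p + x • (Pi.single w (Pi.single 0 1 : Fin 3 → ℝ) : W → Fin 3 → ℝ)) w 0 = x := by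
  rw [cayRay_apply_self, if_pos rfl, hcCayPt_apply_self_zero, zero_add]

/-- Slot `1` (the compact-line angle) of the `x`-ray is the third angle `p w (hcThird i j)`. [cite: Shelstad1979, §4 p. 25] -/
@[simp] theorem cayRay_apply_self_one (p : W → Fin 3 → ℝ) (w : W) (i j : Fin 3) (x : ℝ) :
    (hcCayPt w i j p + x • (Pi.single w (Pi.single 0 1 : Fin 3 → ℝ) : W → Fin 3 → ℝ)) w 1 = p w (hcThird i j) := by
  rw [cayRay_apply_self, if_neg (by decide), add_zero, hcCayPt, Function.update_self]
  rfl

/-- Slot `2` (the phase `θ_w`) of the `x`-ray is the mean `(p w i + p w j) ∕ 2` (`= p w i` on the wall). [cite: Shelstad1979, §4 p. 25] -/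
@[simp] theorem cayRay_apply_self_two (p : W → Fin 3 → ℝ) (w : W) (i j : Fin 3) (x : ℝ) :
    (hcCayPt w i j p + x • (Pi.single w (Pi.single 0 1 : Fin 3 → ℝ) : W → Fin 3 → ℝ)) w 2 = (p w i + p w j) / 2 := by
  rw [cayRay_apply_self, if_neg (by decide), add_zero, hcCayPt, Function.update_self]
  rfl

/-- The `x`-ray does not move the other places. [cite: Shelstad1979, §4 p. 25] -/
@[simp] theorem cayRay_apply_of_ne (p : W → Fin 3 → ℝ) {w w' : W} (h : w' ≠ w) (i j : Fin 3) (x : ℝ) :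
    (hcCayPt w i j p + x • (Pi.single w (Pi.single 0 1 : Fin 3 → ℝ) : W → Fin 3 → ℝ)) w' = p w' := by
  funext l
  simp only [Pi.add_apply, Pi.smul_apply, Pi.single_eq_of_ne h, Pi.zero_apply, smul_zero, add_zero, hcCayPt_apply_of_ne h]

/-- At `x = 0` the ray is at the Cayley point. [cite: Shelstad1979, §4 p. 25] -/
@[simp] theorem cayRay_zero (p : W → Fin 3 → ℝ) (w : W) (i j : Fin 3) : hcCayPt w i j p + (0 : ℝ) • (Pi.single w (Pi.single 0 1 : Fin 3 → ℝ) : W → Fin 3 → ℝ) = hcCayPt w i j p := by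
  rw [zero_smul, add_zero]

/-- The `x`-ray is continuous and passes through the Cayley point at `x = 0`. [cite: Shelstad1979, §4 p. 25] -/
theorem tendsto_cayRay (p : W → Fin 3 → ℝ) (w : W) (i j : Fin 3) :
    Tendsto (fun x : ℝ => hcCayPt w i j p + x • (Pi.single w (Pi.single 0 1 : Fin 3 → ℝ) : W → Fin 3 → ℝ)) (𝓝 0) (𝓝 (hcCayPt w i j p)) := by
  have hc : Continuous fun x : ℝ => hcCayPt w i j p + x • (Pi.single w (Pi.single 0 1 : Fin 3 → ℝ) : W → Fin 3 → ℝ) := continuous_const.add (continuous_id.smul continuous_const)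
  simpa only [zero_smul, add_zero] using hc.tendsto 0

/-- **THE `x`-RAY RUNS IN `RegG (insert w S′)` FOR EVERY `x ≠ 0`**: at the now-split place `w` the real coordinate is `x ≠ 0`; at every other split place `p w′ 0 ≠ 0` and at every
other compact place the three unit eigenvalues of `p` are distinct (★ `HcSemireg`). [cite: Shelstad1979, §4 p. 22] [cite: Varadarajan1977, I §1.12] -/
theorem cayRay_mem_regG_insert {S' : Finset W} {w : W} {i j : Fin 3} {p : W → Fin 3 → ℝ} (hp : HcSemireg S' w i j p) {x : ℝ} (hx : x ≠ 0) :
    hcCayPt w i j p + x • (Pi.single w (Pi.single 0 1 : Fin 3 → ℝ) : W → Fin 3 → ℝ) ∈ RegG (insert w S') := by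
  refine ⟨fun w' hw' => ?_, fun w' hw' => ?_⟩
  · rw [Finset.mem_insert, not_or] at hw'
    rw [cayRay_apply_of_ne p hw'.1]
    exact hp.2.2.1 w' hw'.2 hw'.1
  · by_cases h : w' = w
    · subst h
      rw [cayRay_apply_self_zero]
      exact hx
    · rw [cayRay_apply_of_ne p h]
      rcases Finset.mem_insert.1 hw' with h' | h'
      · exact absurd h' h
      · exact hp.2.2.2 w' h'

/-- **The `x`-ray tends to the Cayley point WITHIN `RegG (insert w S′)`** as `x → 0`, `x ≠ 0`. [cite: Varadarajan1977, I §1.12] [cite: Shelstad1979, Lemma 4.3 (p. 25)] -/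
theorem tendsto_cayRay_nhdsWithin_regG {S' : Finset W} {w : W} {i j : Fin 3} {p : W → Fin 3 → ℝ} (hp : HcSemireg S' w i j p) :
    Tendsto (fun x : ℝ => hcCayPt w i j p + x • (Pi.single w (Pi.single 0 1 : Fin 3 → ℝ) : W → Fin 3 → ℝ)) (𝓝[≠] 0) (𝓝[RegG (insert w S')] (hcCayPt w i j p)) :=
  tendsto_nhdsWithin_iff.2 ⟨(tendsto_cayRay p w i j).mono_left nhdsWithin_le_nhds,
    eventually_nhdsWithin_of_forall fun _ hx => cayRay_mem_regG_insert hp (Set.mem_compl_singleton_iff.1 hx)⟩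

/-- The one-sided form: the `x`-ray tends to the Cayley point within `RegG (insert w S′)` as `x → 0⁺`. [cite: Varadarajan1977, I §1.12] [cite: Shelstad1979, Lemma 4.3 (p. 25)] -/
theorem tendsto_cayRay_nhdsGT_regG {S' : Finset W} {w : W} {i j : Fin 3} {p : W → Fin 3 → ℝ} (hp : HcSemireg S' w i j p) :
    Tendsto (fun x : ℝ => hcCayPt w i j p + x • (Pi.single w (Pi.single 0 1 : Fin 3 → ℝ) : W → Fin 3 → ℝ)) (𝓝[>] 0) (𝓝[RegG (insert w S')] (hcCayPt w i j p)) :=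
  (tendsto_cayRay_nhdsWithin_regG hp).mono_left (nhdsWithin_mono _ fun x (hx : 0 < x) => ne_of_gt hx)

/-- A `RegG (insert w S′)`-limit of `g` at the Cayley point is, in particular, its limit along the `x`-ray `x → 0⁺`. [cite: Varadarajan1977, I §1.12] -/
theorem tendsto_comp_cayRay_of_tendsto {S' : Finset W} {w : W} {i j : Fin 3} {p : W → Fin 3 → ℝ} (hp : HcSemireg S' w i j p)
    {g : (W → Fin 3 → ℝ) → ℂ} {V : ℂ} (h : Tendsto g (𝓝[RegG (insert w S')] (hcCayPt w i j p)) (𝓝 V)) :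
    Tendsto (fun x : ℝ => g (hcCayPt w i j p + x • (Pi.single w (Pi.single 0 1 : Fin 3 → ℝ) : W → Fin 3 → ℝ))) (𝓝[>] 0) (𝓝 V) :=
  h.comp (tendsto_cayRay_nhdsGT_regG hp)

variable [Fintype W] (s : W → Fin 3 → SignType)

/-- **(V1) ALONG THE RAY**: `f` continuous on `InRegG s (insert w S′)`, `f = g` on `RegG (insert w S′)` ⟹ `g (cay + x • e_{w,0}) → f (cay)` as `x → 0⁺` — the value at the Cayley
point is the ONE-VARIABLE ray limit of the raw member with every other coordinate frozen. [cite: Varadarajan1977, I §1.12] [cite: Shelstad1979, Lemma 4.3 (p. 25)]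
[cite: Bouaziz1994IntegralesOrbitales, §3.1 (I₂) p. 579] -/
theorem tendsto_comp_cayRay_of_continuousOn {S' : Finset W} {w : W} {i j : Fin 3} {p : W → Fin 3 → ℝ} (hp : HcSemireg S' w i j p)
    {f g : (W → Fin 3 → ℝ) → ℂ} (hf : ContinuousOn f (InRegG s (insert w S'))) (hfg : EqOn f g (RegG (insert w S'))) :
    Tendsto (fun x : ℝ => g (hcCayPt w i j p + x • (Pi.single w (Pi.single 0 1 : Fin 3 → ℝ) : W → Fin 3 → ℝ))) (𝓝[>] 0) (𝓝 (f (hcCayPt w i j p))) :=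
  tendsto_comp_cayRay_of_tendsto hp (tendsto_nhdsWithin_regG_hcCayPt_of_continuousOn s hp hf hfg)

/-- **UNIQUENESS ALONG THE RAY**: under (V1)'s hypotheses, a computed ray limit `V` of the raw member IS the value `f (hcCayPt w i j p)` (`𝓝[>] 0` is non-trivial).
[cite: Varadarajan1977, I §1.12] [cite: Shelstad1979, Lemma 4.3 (p. 25)] -/
theorem eq_of_tendsto_comp_cayRay {S' : Finset W} {w : W} {i j : Fin 3} {p : W → Fin 3 → ℝ} (hp : HcSemireg S' w i j p)
    {f g : (W → Fin 3 → ℝ) → ℂ} (hf : ContinuousOn f (InRegG s (insert w S'))) (hfg : EqOn f g (RegG (insert w S'))) {V : ℂ}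
    (h : Tendsto (fun x : ℝ => g (hcCayPt w i j p + x • (Pi.single w (Pi.single 0 1 : Fin 3 → ℝ) : W → Fin 3 → ℝ))) (𝓝[>] 0) (𝓝 V)) : f (hcCayPt w i j p) = V :=
  tendsto_nhds_unique (tendsto_comp_cayRay_of_continuousOn s hp hf hfg) h

end Ray

/-! ## §3 The genuine family: the value of `orbFamGExt` at the Cayley point is a limit of `orbFamG` -/

section Genuine

open scoped Classical

variable (L : Type) [Field L] [NumberField L] [IsCMField L] (α : Fin 3 → L)
  [MeasurableSpace ↥(arch (↥(maximalRealSubfield L)) L (IsCMField.complexConj L) 3 (Matrix.diagonal α))] [BorelSpace ↥(arch (↥(maximalRealSubfield L)) L (IsCMField.complexConj L) 3 (Matrix.diagonal α))]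
  (ν' : Measure ↥(arch (↥(maximalRealSubfield L)) L (IsCMField.complexConj L) 3 (Matrix.diagonal α))) [IsFiniteMeasureOnCompacts ν'] [ν'.IsMulRightInvariant]
  (a' : ↥(arch (↥(maximalRealSubfield L)) L (IsCMField.complexConj L) 3 (Matrix.diagonal α)) → ℂ)

/-- **(V1-G′) FOR THE GENUINE FAMILY**: if the wall-extended member `orbFamGExt ν′ a′ (insert w S′)` is `C^∞` on `InRegG (slotSign L α) (insert w S′)` (clause (I₁)+(I₂) of the letter
L1 membership on the chart `insert w S′`), then at the Cayley point of every semiregular wall point the RAW member `orbFamG ν′ a′ (insert w S′)` (= `R′ · chartOrbG` on an admissible label)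
tends along `𝓝[RegG (insert w S′)]` to the value `orbFamGExt ν′ a′ (insert w S′) (hcCayPt w i j p)`. [cite: Varadarajan1977, I §1.12] [cite: Shelstad1979, Lemma 4.3 (p. 25)]
[cite: Bouaziz1994IntegralesOrbitales, §3.1 (I₂) p. 579] -/
theorem tendsto_orbFamG_nhdsWithin_regG_hcCayPt {S' : Finset {w : InfinitePlace L // IsComplex w}} {w : {w : InfinitePlace L // IsComplex w}} {i j : Fin 3}
    {p : {w : InfinitePlace L // IsComplex w} → Fin 3 → ℝ} (hsm : ContDiffOn ℝ ∞ (orbFamGExt L α ν' a' (insert w S')) (InRegG (slotSign L α) (insert w S')))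
    (hp : HcSemireg S' w i j p) :
    Tendsto (orbFamG L α ν' a' (insert w S')) (𝓝[RegG (insert w S')] (hcCayPt w i j p)) (𝓝 (orbFamGExt L α ν' a' (insert w S') (hcCayPt w i j p))) :=
  tendsto_nhdsWithin_regG_hcCayPt_of_contDiffOn (slotSign L α) hp hsm (orbFamGExt_eqOn_regG L α ν' a' (insert w S'))

/-- (V1-G′) from the full letter-L1 MEMBERSHIP `orbFamGExt ν′ a′ ∈ I_c(G′_∞)` (★ `ArchHCSpaceG (slotSign L α) jc′ (orbFamGExt ν′ a′)`; only clause (I₁)+(I₂) on `insert w S′` is read).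
[cite: Bouaziz1994IntegralesOrbitales, §3.2 p. 580] [cite: Varadarajan1977, I §1.12] -/
theorem tendsto_orbFamG_nhdsWithin_regG_hcCayPt_of_archHCSpaceG {jc' : Finset {w : InfinitePlace L // IsComplex w} → {w : InfinitePlace L // IsComplex w} → Fin 3 → Fin 3 → ℂ}
    (hF : ArchHCSpaceG (slotSign L α) jc' (orbFamGExt L α ν' a')) {S' : Finset {w : InfinitePlace L // IsComplex w}} {w : {w : InfinitePlace L // IsComplex w}} {i j : Fin 3}
    {p : {w : InfinitePlace L // IsComplex w} → Fin 3 → ℝ} (hp : HcSemireg S' w i j p) :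
    Tendsto (orbFamG L α ν' a' (insert w S')) (𝓝[RegG (insert w S')] (hcCayPt w i j p)) (𝓝 (orbFamGExt L α ν' a' (insert w S') (hcCayPt w i j p))) :=
  tendsto_orbFamG_nhdsWithin_regG_hcCayPt L α ν' a' (hF.2.2.1 (insert w S')).1 hp

/-- **(V1-G′) ALONG THE `x`-RAY**: under `hsm`, `orbFamG ν′ a′ (insert w S′) (cay + x • e_{w,0}) → orbFamGExt ν′ a′ (insert w S′) (cay)` as `x → 0⁺` — the one-variable limit (V2) computes.
[cite: Varadarajan1977, I §1.12] [cite: Shelstad1979, Lemma 4.3 (p. 25)] -/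
theorem tendsto_orbFamG_cayRay {S' : Finset {w : InfinitePlace L // IsComplex w}} {w : {w : InfinitePlace L // IsComplex w}} {i j : Fin 3}
    {p : {w : InfinitePlace L // IsComplex w} → Fin 3 → ℝ} (hsm : ContDiffOn ℝ ∞ (orbFamGExt L α ν' a' (insert w S')) (InRegG (slotSign L α) (insert w S')))
    (hp : HcSemireg S' w i j p) :
    Tendsto (fun x : ℝ => orbFamG L α ν' a' (insert w S') (hcCayPt w i j p + x • (Pi.single w (Pi.single 0 1 : Fin 3 → ℝ) : {w : InfinitePlace L // IsComplex w} → Fin 3 → ℝ))) (𝓝[>] 0)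
      (𝓝 (orbFamGExt L α ν' a' (insert w S') (hcCayPt w i j p))) :=
  tendsto_comp_cayRay_of_tendsto hp (tendsto_orbFamG_nhdsWithin_regG_hcCayPt L α ν' a' hsm hp)

/-- (V1-G′) along the `x`-ray, from the membership. [cite: Bouaziz1994IntegralesOrbitales, §3.2 p. 580] [cite: Varadarajan1977, I §1.12] -/
theorem tendsto_orbFamG_cayRay_of_archHCSpaceG {jc' : Finset {w : InfinitePlace L // IsComplex w} → {w : InfinitePlace L // IsComplex w} → Fin 3 → Fin 3 → ℂ}
    (hF : ArchHCSpaceG (slotSign L α) jc' (orbFamGExt L α ν' a')) {S' : Finset {w : InfinitePlace L // IsComplex w}} {w : {w : InfinitePlace L // IsComplex w}} {i j : Fin 3}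
    {p : {w : InfinitePlace L // IsComplex w} → Fin 3 → ℝ} (hp : HcSemireg S' w i j p) :
    Tendsto (fun x : ℝ => orbFamG L α ν' a' (insert w S') (hcCayPt w i j p + x • (Pi.single w (Pi.single 0 1 : Fin 3 → ℝ) : {w : InfinitePlace L // IsComplex w} → Fin 3 → ℝ))) (𝓝[>] 0)
      (𝓝 (orbFamGExt L α ν' a' (insert w S') (hcCayPt w i j p))) :=
  tendsto_orbFamG_cayRay L α ν' a' (hF.2.2.1 (insert w S')).1 hp

/-- **THE (V2)-SOCKET**: under `hsm`, a COMPUTED `x`-ray limit `V` of the raw member at the Cayley point IS the value: `orbFamGExt ν′ a′ (insert w S′) (hcCayPt w i j p) = V` — so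
(I₃)'s right side for the extended genuine family reads `V` (★ `orbFamGExt_insert_hcCayPt_eq_of_tendsto` needs the full `RegG`-limit; here the one-ray computation suffices).
[cite: Varadarajan1977, I §1.12] [cite: Shelstad1979, Lemma 4.3 (p. 25)] [cite: Bouaziz1994IntegralesOrbitales, §3.1 (I₂) p. 579] -/
theorem orbFamGExt_insert_hcCayPt_eq_of_tendsto_cayRay {S' : Finset {w : InfinitePlace L // IsComplex w}} {w : {w : InfinitePlace L // IsComplex w}} {i j : Fin 3}
    {p : {w : InfinitePlace L // IsComplex w} → Fin 3 → ℝ} (hsm : ContDiffOn ℝ ∞ (orbFamGExt L α ν' a' (insert w S')) (InRegG (slotSign L α) (insert w S')))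
    (hp : HcSemireg S' w i j p) {V : ℂ}
    (h : Tendsto (fun x : ℝ => orbFamG L α ν' a' (insert w S') (hcCayPt w i j p + x • (Pi.single w (Pi.single 0 1 : Fin 3 → ℝ) : {w : InfinitePlace L // IsComplex w} → Fin 3 → ℝ))) (𝓝[>] 0) (𝓝 V)) :
    orbFamGExt L α ν' a' (insert w S') (hcCayPt w i j p) = V :=
  tendsto_nhds_unique (tendsto_orbFamG_cayRay L α ν' a' hsm hp) h

/-- The (V2)-socket from the membership. [cite: Bouaziz1994IntegralesOrbitales, §3.2 p. 580] [cite: Varadarajan1977, I §1.12] -/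
theorem orbFamGExt_insert_hcCayPt_eq_of_tendsto_cayRay_of_archHCSpaceG
    {jc' : Finset {w : InfinitePlace L // IsComplex w} → {w : InfinitePlace L // IsComplex w} → Fin 3 → Fin 3 → ℂ} (hF : ArchHCSpaceG (slotSign L α) jc' (orbFamGExt L α ν' a'))
    {S' : Finset {w : InfinitePlace L // IsComplex w}} {w : {w : InfinitePlace L // IsComplex w}} {i j : Fin 3} {p : {w : InfinitePlace L // IsComplex w} → Fin 3 → ℝ}
    (hp : HcSemireg S' w i j p) {V : ℂ}
    (h : Tendsto (fun x : ℝ => orbFamG L α ν' a' (insert w S') (hcCayPt w i j p + x • (Pi.single w (Pi.single 0 1 : Fin 3 → ℝ) : {w : InfinitePlace L // IsComplex w} → Fin 3 → ℝ))) (𝓝[>] 0) (𝓝 V)) :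
    orbFamGExt L α ν' a' (insert w S') (hcCayPt w i j p) = V :=
  orbFamGExt_insert_hcCayPt_eq_of_tendsto_cayRay L α ν' a' (hF.2.2.1 (insert w S')).1 hp h

end Genuine

end Literature.NumberTheory.Rogawski1990

end
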